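import Summits.BirchSwinnertonDyer.BirchSwinnertonDyer.Theorems.GenusKolyvaginAtTwoK4NegPhantomDeepTwistSha
import Summits.BirchSwinnertonDyer.BirchSwinnertonDyer.Theorems.GenusKolyvaginAtTwoEquivariantKolyvaginExactAtTwoEigenClassesFinite
import Summits.BirchSwinnertonDyer.BirchSwinnertonDyer.Theorems.GenusKolyvaginAtTwoCasselsTateNumberField
import Literature.NumberTheory.EllipticCurves.TwoTorsionOddDegreeBaseChangeProofs
import HarnessLib

/-!
# Route `GenusKolyvaginAtTwo`, crux K₄⁻ `K4Neg` (stmt-BirchSwinnertonDyer-31526), the (β)/𝒫-frames — PHANTOM PERSISTENCE UNDER DEEP TWISTING, part 4: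
# the genus pair over `K`: `Ш(E^{(D)}/K)[2] ≠ 0` as soon as one member over `ℚ` has `#Sel₂ ≥ 4` (the input `s_n ≥ 1` of the genus ledger)

Seat `bsd-line-gk2-p3` g35 (PROVER seat 3/3, cell `bsd-f1-sign2`), sequel of parts 1–3 (p792861, p793066, p793464), `--supports stmt-BirchSwinnertonDyer-31526
--as helper`.  THEOREMS ONLY (no definition, no named fact, no `sorry`); standard axioms; UNCONDITIONAL.  **BSD is NOT proved by this file; K4Neg is neither
proved nor refuted by it; nothing is closed.**

WHY.  The genus–Gross–Zagier ledger of the memo `K4NEG-BETA-GENUS-VERDICT-gk2p3-g35.md` (evidence on the item) reads, at a square-free product `n` of deep primes,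
`k_n = ω(n) + ½·ord₂ #Ш(E^{(D_n)}/K)[2^∞]` for the `2`-adic depth `k_n` of the `χ_n`-Heegner vector; `P(n) ∈ 2E(K[n])` follows from `Ш(E^{(D_n)}/K)[2] ≠ 0`.  Over
`K = ℚ(√−ℓ₀)` the curve `E^{(D_n)}` IS the pair `(E^{(D_n)}, E^{(−ℓ₀D_n)})`; parts 1–3 put the phantom `ξ_E` in `Sel₂` of both members and in `Ш[2]` of the rank-`0`
one.  THIS FILE is the passage to `K`: Gross's `Sel₂(X^{(d_K)}/ℚ) ↪ Sel₂(X/K)` at `p = 2` (injective because `X(K)[2] = 0` under `ρ̄_{X,2}` onto) and the exact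
descent count over `K`.

WHAT (for `X/ℚ` elliptic with `ρ̄_{X,2}` onto, `K` an imaginary quadratic field; `hPsiKT`, `resTorsion`, `natCard_selmerGroup_eq` are tree theorems).
* §1 `natCard_selmerGroup_le_natCard_selmerGroup_baseChange_two` — `#Sel₂(X/ℚ) ≤ #Sel₂(X/K)`; ★ `natCard_selmerGroup_quadraticTwist_discr_le_natCard_selmerGroup_baseChange_two`
  — `#Sel₂(X^{(d_K)}/ℚ) ≤ #Sel₂(X/K)` (and for every model `C • X^{(d_K)}`): Gross 1991 §5 (5.1) at `p = 2`, via the tree's `hPsiKT ∘ res` and inflation–restriction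
  injectivity (`EigenClassesFinite.resTorsion_injective_of_noTorsion`, `X(K)[2] = 0` from Dokchitser–Dokchitser (1)).
* §2 ★★ `two_le_natCard_sha_baseChange_of_four_le_natCard_selmerGroup_twist` — if `rank X(K) = 1` and some model of `X` or of `X^{(d_K)}` over `ℚ` has `#Sel₂ ≥ 4`,
  then `#(Ш(X/K) ⊓ H¹(K, X)[2]) ≥ 2` (descent count over `K`: `#Sel₂(X/K) = 2·#X(K)[2]·#Ш[2] = 2·#Ш[2]`).
* §3 `four_le_natCard_selmerGroup_of_rank_zero` — CT upgrade over `ℚ` (any number field): `ρ̄₂` onto, rank `0`, `Ш[2^∞]` finite, `#Sel₂ ≥ 2` ⟹ `#Sel₂ ≥ 4`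
  (`#Sel₂ = #Ш[2]` is a square: `CasselsTateNumberField.isSquare_natCard_sha_torsionBy_pow`, unconditional).
* §4 ★★★ `two_le_natCard_sha_baseChange_deepTwist_of_phantom_selmer` — THE INPUT `s_ℓ ≥ 1` OF THE GENUS LEDGER AT A DEEP PRIME: phantom cell, 𝒫-frame
  `K = ℚ(√−ℓ₀)` (`4 ∣ a_{ℓ₀}`, `2` split), `ℓ` a K4Neg-deep prime with `ℓ ≡ 7 (8)`, `X` any model of `W^{(−ℓ)}`, `X'` any model of `W^{(ℓℓ₀)}`; IF `rank X(K) = 1` and one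
  of `X`, `X'` has Mordell–Weil rank `0` with `Ш[2^∞]` finite (the GZK shape of «`L′(E/K, χ_ℓ, 1) ≠ 0`»), THEN `#(Ш(X/K) ⊓ H¹[2]) ≥ 2`.  (Parts 1–3 + §1–§3.)
  With (★) of the memo this is `k_ℓ ≥ 2`, i.e. `P(ℓ) ∈ 2E(K[ℓ])` — the 𝒫-half of LEAD-BRIEF-g29 §3 decided NEGATIVELY modulo BSD₂ of the pair + the explicit GZ formula.

References: [GrossLMS1991] §5 (5.1); [SilvermanAEC2009] Thm. X.4.2, X.5 Cor. 5.4; [DokchitserDokchitserMathZ2012] Thm. (1); [Cassels1962ArithmeticIV] §1;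
[MazurRubin2010] Lemma 3.2; [LawsonWuthrich2016] §7.1.
-/

set_option linter.dupNamespace false -- tree convention: `Summit.BirchSwinnertonDyer.BirchSwinnertonDyer.Theorems` (summit = sub-problem)
set_option autoImplicit false

noncomputable section

open scoped Classical NumberField AddSubgroup

namespace Summit.BirchSwinnertonDyer.BirchSwinnertonDyer.Theorems.GenusExact.PhantomDescentBit.DeepTwist

open WeierstrassCurve Field NumberField IsDedekindDomain
open Literature.NumberTheory.EllipticCurves Literature.NumberTheory.GaloisRepresentations
open Literature.NumberTheory.QuadraticFields

/-! ## §1 Gross's `Sel₂(X/ℚ), Sel₂(X^{(d_K)}/ℚ) ↪ Sel₂(X/K)` at `p = 2` -/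

section OverK

variable (X : WeierstrassCurve ℚ) [X.IsElliptic] (K : Type) [Field K] [NumberField K]

/-- **`#Sel₂(X/ℚ) ≤ #Sel₂(X/K)`** for `K` quadratic with `X(K)[2] = 0` (here: `ρ̄_{X,2}` onto — Dokchitser–Dokchitser (1) over a quadratic field): restriction
carries `Sel₂(X/ℚ)` into `Sel₂(X/K)` (`resTorsion_mem_selmerGroup`) and is injective by inflation–restriction (`EigenClassesFinite.resTorsion_injective_of_noTorsion`).
[cite: GrossLMS1991, §5 (5.1)] [cite: SerreGaloisCohomology1997, I §2.6 (b)] -/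
theorem natCard_selmerGroup_le_natCard_selmerGroup_baseChange_two (h2 : Module.finrank ℚ K = 2) (hs : X.HasSurjectiveModNGaloisRep 2) :
    Nat.card (X.selmerGroup 2) ≤ Nat.card ((X.baseChange K).selmerGroup 2) := by
  obtain ⟨θ, c, hθ, hc⟩ := Quadratic.exists_sq_eq_algebraMap (F := ℚ) (K := K) h2
  haveI : Finite ((X.baseChange K).selmerGroup (2 : ℤ)) := (X.baseChange K).finite_selmerGroup_holds two_ne_zero
  have hL : ∀ P : (X.baseChange K).toAffine.Point, (2 : ℤ) • P = 0 → P = 0 :=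
    forall_two_zsmul_baseChange_of_hasSurjectiveModNGaloisRep_two X hs K (by rw [h2]; decide)
  have hinj := EigenClassesFinite.resTorsion_injective_of_noTorsion X K h2 hθ hc (2 : ℤ) hL
  let f : X.selmerGroup (2 : ℤ) → (X.baseChange K).selmerGroup (2 : ℤ) := fun x ↦
    ⟨resTorsion X K (2 : ℤ) x, resTorsion_mem_selmerGroup X K (2 : ℤ) x.2⟩
  have hf : Function.Injective f := fun a b h ↦ Subtype.ext (hinj (congrArg Subtype.val h))
  exact Nat.card_le_card_of_injective f hf

/-- ★ **`#Sel₂(Xd/ℚ) ≤ #Sel₂(X/K)` for every model `Xd` of the twist `X^{(d_K)}`** (`K` imaginary quadratic, `ρ̄_{X,2}` onto): Gross's `Sel(E^{(D)}/ℚ) ↪ Sel(E/K)^−`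
at `p = 2` — `x ↦ hPsiKT(res x)` (`hPsiKT_resTorsion_mem_selmerGroup_and_conjAct_eq`) is injective since `X^{(c)}(K)[2] = 0` (`ρ̄₂` onto is twist-invariant) and `hPsiKT` is an
isomorphism; `d_K = c·q²` and model-invariance of `#Sel₂` as in `natCard_selmerGroup_quadraticTwist_discr_le_of_forall_mem`.
[cite: GrossLMS1991, §5 (5.1)] [cite: SilvermanAEC2009, X.5 Cor. 5.4] [cite: DokchitserDokchitserMathZ2012, Theorem (1)] -/
theorem natCard_selmerGroup_quadraticTwist_discr_le_natCard_selmerGroup_baseChange_two (hK : IsImaginaryQuadratic K)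
    (hs : X.HasSurjectiveModNGaloisRep 2) (Xd : WeierstrassCurve ℚ) [Xd.IsElliptic] {C : VariableChange ℚ}
    (hXd : C • X.quadraticTwist (NumberField.discr K : ℚ) = Xd) :
    Nat.card (Xd.selmerGroup 2) ≤ Nat.card ((X.baseChange K).selmerGroup 2) := by
  have h2 := hK.1
  obtain ⟨θ, c, hθ, hc⟩ := Quadratic.exists_sq_eq_algebraMap (F := ℚ) (K := K) h2
  obtain ⟨q, hq, hd⟩ := NumberField.exists_discr_eq_mul_sq h2 hθ hc
  obtain ⟨C', hC'⟩ := X.exists_variableChange_quadraticTwist_mul_sq c q hq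
  rw [← hd] at hC'
  -- `#Sel₂(Xd) = #Sel₂(X^{(d_K)}) = #Sel₂(X^{(c)})`
  have hc0 : c ≠ 0 := by
    rintro rfl
    apply hθ
    rw [map_zero, sq_eq_zero_iff] at hc
    exact ⟨0, by rw [map_zero, hc]⟩
  haveI : (X.quadraticTwist c).IsElliptic := X.isElliptic_quadraticTwist hc0
  have hcard : Nat.card (Xd.selmerGroup 2) = Nat.card ((X.quadraticTwist c).selmerGroup 2) :=
    ((natCard_selmerGroup_eq_of_variableChange (2 : ℤ) hC').trans (natCard_selmerGroup_eq_of_variableChange (2 : ℤ) hXd)).symm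
  rw [hcard]
  -- injectivity of `res` for the twist: `X^{(c)}(K)[2] = 0`
  haveI : Finite ((X.baseChange K).selmerGroup (2 : ℤ)) := (X.baseChange K).finite_selmerGroup_holds two_ne_zero
  have hs' : (X.quadraticTwist c).HasSurjectiveModNGaloisRep 2 := (hasSurjectiveModNGaloisRep_two_quadraticTwist_iff X hc0).mpr hs
  have hL : ∀ P : ((X.quadraticTwist c).baseChange K).toAffine.Point, (2 : ℤ) • P = 0 → P = 0 :=
    forall_two_zsmul_baseChange_of_hasSurjectiveModNGaloisRep_two (X.quadraticTwist c) hs' K (by rw [h2]; decide)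
  have hinj := EigenClassesFinite.resTorsion_injective_of_noTorsion (X.quadraticTwist c) K h2 hθ hc (2 : ℤ) hL
  let f : (X.quadraticTwist c).selmerGroup (2 : ℤ) → (X.baseChange K).selmerGroup (2 : ℤ) := fun x ↦
    ⟨hPsiKT X K hθ hc (2 : ℤ) (resTorsion (X.quadraticTwist c) K (2 : ℤ) x),
      (hPsiKT_resTorsion_mem_selmerGroup_and_conjAct_eq X K h2 hθ hc (2 : ℤ) x.2).1⟩
  have hf : Function.Injective f := fun a b h ↦
    Subtype.ext (hinj ((hPsiKT X K hθ hc (2 : ℤ)).injective (congrArg Subtype.val h)))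
  exact Nat.card_le_card_of_injective f hf

/-! ## §2 ★★ The descent count over `K`: one member with `#Sel₂ ≥ 4` forces `Ш(X/K)[2] ≠ 0` -/

/-- ★★ **`rank X(K) = 1` and `#Sel₂ ≥ 4` for some model of `X` or of `X^{(d_K)}` over `ℚ` ⟹ `#(Ш(X/K) ⊓ H¹(K,X)[2]) ≥ 2`.**  `K` imaginary quadratic, `ρ̄_{X,2}` onto (so
`X(K)[2] = 0`): by §1 `#Sel₂(X/K) ≥ 4`, and the exact count `#Sel₂(X/K) = 2^{rank X(K)}·#X(K)[2]·#(Ш ⊓ H¹[2]) = 2·#(Ш ⊓ H¹[2])` (Silverman X.4.2, tree `natCard_selmerGroup_eq`).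
[cite: SilvermanAEC2009, Thm. X.4.2] [cite: GrossLMS1991, §5 (5.1)] -/
theorem two_le_natCard_sha_baseChange_of_four_le_natCard_selmerGroup_twist (hK : IsImaginaryQuadratic K)
    (hs : X.HasSurjectiveModNGaloisRep 2) (hr : (X.baseChange K).mordellWeilRank = 1)
    (Y : WeierstrassCurve ℚ) [Y.IsElliptic] {C : VariableChange ℚ}
    (hY : C • X = Y ∨ C • X.quadraticTwist (NumberField.discr K : ℚ) = Y) (h4 : 4 ≤ Nat.card (Y.selmerGroup 2)) :
    2 ≤ Nat.card ((X.baseChange K).sha ⊓ AddSubgroup.torsionBy (X.baseChange K).galH1 2 : AddSubgroup (X.baseChange K).galH1) := by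
  -- `#Sel₂(X/K) ≥ 4`
  have hSel : 4 ≤ Nat.card ((X.baseChange K).selmerGroup 2) := by
    rcases hY with hY | hY
    · have h := natCard_selmerGroup_le_natCard_selmerGroup_baseChange_two X K hK.1 hs
      rw [← natCard_selmerGroup_eq_of_variableChange (2 : ℤ) hY] at h4
      exact h4.trans h
    · exact h4.trans (natCard_selmerGroup_quadraticTwist_discr_le_natCard_selmerGroup_baseChange_two X K hK hs Y hY)
  -- `X(K)[2] = 0`
  have hbot : (X.baseChange K).toAffine.Point[((2 : ℕ) : ℤ)] = ⊥ := by
    refine (AddSubgroup.eq_bot_iff_forall _).mpr fun P hP ↦ ?_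
    have h2Z : ((2 : ℕ) : ℤ) • P = 0 := (Submodule.mem_torsionBy_iff ((2 : ℕ) : ℤ) P).mp hP
    have h2P : 2 • P = 0 := by rwa [natCast_zsmul] at h2Z
    exact forall_two_nsmul_baseChange_of_hasSurjectiveModNGaloisRep_two_of_isImaginaryQuadratic X hs K hK P h2P
  have ht : Nat.card ((X.baseChange K).toAffine.Point[((2 : ℕ) : ℤ)]) = 1 := by
    rw [hbot, AddSubgroup.card_bot]
  -- the count
  have h := (X.baseChange K).natCard_selmerGroup_eq (n := 2) two_ne_zero
  rw [hr, pow_one, ht, mul_one] at h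
  have hSel' : 4 ≤ Nat.card ((X.baseChange K).selmerGroup ((2 : ℕ) : ℤ)) := hSel
  rw [h] at hSel'
  change 2 ≤ Nat.card ((X.baseChange K).sha ⊓ AddSubgroup.torsionBy (X.baseChange K).galH1 ((2 : ℕ) : ℤ) :
    AddSubgroup (X.baseChange K).galH1)
  omega

/-! ## §3 Cassels–Tate upgrade over the rationals: rank `0` and `#Sel₂ ≥ 2` give `#Sel₂ ≥ 4` -/

/-- **Rank `0`, `ρ̄₂` onto, `Ш[2^∞]` finite, `#Sel₂ ≥ 2` ⟹ `#Sel₂ ≥ 4`** (any number field): `#Sel₂ = #Ш[2]` (X.4.2 with `E(L)[2] = 0`), and `#Ш[2]` is a square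
(Cassels–Tate, tree `CasselsTateNumberField.isSquare_natCard_sha_torsionBy_pow`, unconditional given finiteness of `Ш[2^∞]`); a square `≥ 2` is `≥ 4`.
[cite: Cassels1962ArithmeticIV, §1] [cite: SilvermanAEC2009, Thm. X.4.2] -/
theorem four_le_natCard_selmerGroup_of_rank_zero {L : Type} [Field L] [NumberField L] (V : WeierstrassCurve L) [V.IsElliptic]
    (hs : V.HasSurjectiveModNGaloisRep 2) (hr : V.mordellWeilRank = 0) [Finite (AddCommGroup.primaryComponent V.sha 2)]
    (hS : 2 ≤ Nat.card (V.selmerGroup 2)) : 4 ≤ Nat.card (V.selmerGroup 2) := by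
  haveI : Fact (Nat.Prime 2) := ⟨Nat.prime_two⟩
  -- `V(L)[2] = 0`
  have hbot : V.toAffine.Point[((2 : ℕ) : ℤ)] = ⊥ := by
    refine (AddSubgroup.eq_bot_iff_forall _).mpr fun P hP ↦ ?_
    have h2Z : ((2 : ℕ) : ℤ) • P = 0 := (Submodule.mem_torsionBy_iff ((2 : ℕ) : ℤ) P).mp hP
    have h2P : 2 • P = 0 := by rwa [natCast_zsmul] at h2Z
    exact DokchitserDokchitser2012.forall_two_nsmul_of_hasSurjectiveModNGaloisRep_two V two_ne_zero hs P h2P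
  have ht : Nat.card (V.toAffine.Point[((2 : ℕ) : ℤ)]) = 1 := by
    rw [hbot, AddSubgroup.card_bot]
  have h := V.natCard_selmerGroup_eq (n := 2) two_ne_zero
  rw [hr, pow_zero, one_mul, ht, one_mul, ← Literature.Algebra.Module.natCard_torsionBy_addSubgroup] at h
  -- `#Sel₂ = #Ш[2]`, a square
  have hsq : IsSquare (Nat.card (AddSubgroup.torsionBy V.sha ((2 ^ 1 : ℕ) : ℤ))) :=
    CasselsTateNumberField.isSquare_natCard_sha_torsionBy_pow V 2 1
  rw [pow_one] at hsq
  have hS' : 2 ≤ Nat.card (V.selmerGroup ((2 : ℕ) : ℤ)) := hS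
  change 4 ≤ Nat.card (V.selmerGroup ((2 : ℕ) : ℤ))
  rw [h] at hS' ⊢
  obtain ⟨m, hm⟩ := hsq
  rw [hm] at hS' ⊢
  have hm2 : 2 ≤ m := by
    by_contra hlt
    push Not at hlt
    interval_cases m <;> omega
  nlinarith

end OverK

/-! ## §4 ★★★ The input `s_ℓ ≥ 1` of the genus ledger at a deep prime of a 𝒫-frame -/

section PFrameLedger

/-- **A change of variables commutes with twisting, up to a change of variables**: `(C • W)^{(d)} = ⟨u, d·r, 0, 0⟩ • W^{(d)}` for the tree's twist model
`W^{(d)} = [0, d b₂/4, 0, d² b₄/2, d³ b₆/4]` (the `b`-invariants transform by `u`, `r` only). [cite: SilvermanAEC2009, III.1 Table 3.1, X.5 Cor. 5.4] -/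
theorem smul_quadraticTwist_eq_smul (W : WeierstrassCurve ℚ) (C : VariableChange ℚ) (d : ℚ) :
    (C • W).quadraticTwist d = (⟨C.u, d * C.r, 0, 0⟩ : VariableChange ℚ) • W.quadraticTwist d := by
  ext
  · simp [quadraticTwist, variableChange_a₁]
  · simp only [quadraticTwist, variableChange_a₂, variableChange_a₁, b₂]
    ring
  · simp [quadraticTwist, variableChange_a₃]
  · simp only [quadraticTwist, variableChange_a₄, variableChange_a₁, variableChange_a₃, b₂, b₄]
    ring
  · simp only [quadraticTwist, variableChange_a₆, variableChange_a₁, variableChange_a₃, b₂, b₄, b₆]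
    ring

/-- **Models of iterated twists**: if `CX • W^{(a)} = X` and `CX' • W^{(b·a)} = X'`, then `X'` is a model of `X^{(b)}` (`(W^{(a)})^{(b)} = W^{(a b)}` on the nose,
`quadraticTwist_quadraticTwist`, and the previous lemma). [cite: SilvermanAEC2009, X.5 Cor. 5.4] -/
theorem exists_smul_quadraticTwist_eq_of_models (W X X' : WeierstrassCurve ℚ) {a b : ℚ} {CX CX' : VariableChange ℚ}
    (hX : CX • W.quadraticTwist a = X) (hX' : CX' • W.quadraticTwist (b * a) = X') :
    ∃ C'' : VariableChange ℚ, C'' • X.quadraticTwist b = X' := by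
  refine ⟨CX' * (⟨CX.u, b * CX.r, 0, 0⟩ : VariableChange ℚ)⁻¹, ?_⟩
  rw [← hX, smul_quadraticTwist_eq_smul, mul_smul, inv_smul_smul, quadraticTwist_quadraticTwist, mul_comm a b, hX']

variable (W : WeierstrassCurve ℚ) [W.IsElliptic] [W.IsGloballyMinimal] [NeZero (W.conductorNorm ℤ)]

/-- ★★★ **ON A 𝒫-FRAME, AT EVERY DEEP PRIME `ℓ ≡ 7 (8)`, `Ш(E^{(−ℓ)}/K)[2] ≠ 0` — granted the GZK shape of «`L′(E/K, χ_ℓ, 1) ≠ 0`».**  Phantom cell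
(`W/ℚ` globally minimal, `C(W)` odd, off the cut, `Δ < 0`, `ρ̄_{W,2}`, `ρ_{W,4}` onto, the Lawson–Wuthrich class `ξ` SELMER); prime Heegner frame `K = ℚ(√−ℓ₀)`
(`d_K = −ℓ₀` odd, Heegner for `N_W`, `2` split) which is 𝒫 (`4 ∣ a_{ℓ₀}(W)`); `ℓ` a K4Neg-deep prime (`ℓ ∤ N_W`, `FrobEqFrobInfty W K 2 ℓ`, `2 ≤ kolyvaginIndex W 2 ℓ`) with
`ℓ ≡ 7 (8)`, `ℓ ≠ ℓ₀`; `X` any elliptic model of `W^{(−ℓ)}`, `X'` any elliptic model of `W^{(ℓℓ₀)}` (the genus pair at level `ℓ`; over `K`, `X' ≅ X`).  IF `rank X(K) = 1`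
and one of `X`, `X'` has Mordell–Weil rank `0` with `Ш[2^∞]` finite, THEN `#(Ш(X/K) ⊓ H¹(K,X)[2]) ≥ 2`.  Chain: parts 1–2 (`ξ ∈ Sel₂` of both members, so
`#Sel₂ ≥ 2`), §3 (the rank-`0` member has `#Sel₂ ≥ 4`: Cassels–Tate), §1–§2 (Gross's injection into `Sel₂(X/K)` and the descent count over `K`).  With the memo's (★)
(`k_ℓ = 1 + ½·ord₂ #Ш(X/K)[2^∞]`) this gives `k_ℓ ≥ 2`, i.e. `P(ℓ) ∈ 2E(K[ℓ])`.  BSD is NOT proved by this; K4Neg is neither proved nor refuted here.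
[cite: GrossLMS1991, §3 (3.1)–(3.3), §5 (5.1), §9 Prop. 9.6] [cite: SilvermanAEC2009, Thm. X.4.2] [cite: Cassels1962ArithmeticIV, §1]
[cite: MazurRubin2010, Lemma 3.2] [cite: LawsonWuthrich2016, §7.1] -/
theorem two_le_natCard_sha_baseChange_deepTwist_of_phantom_selmer {K : Type} [Field K] [NumberField K]
    (hT : Odd W.tamagawaProduct)
    (hoff : ¬ ∃ v : HeightOneSpectrum (𝓞 ℚ), ((2 : ℕ) : 𝓞 ℚ) ∉ v.asIdeal ∧ ((W.conductorNorm ℤ : ℕ) : 𝓞 ℚ) ∈ v.asIdeal ∧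
      W.HasMultiplicativeReductionAt v)
    (hΔ : W.Δ < 0) (hsurj : W.HasSurjectiveModNGaloisRep 2) (hsurj4 : W.HasSurjectiveModNGaloisRep 4)
    {ξ : galH1Torsion W (2 : ℤ)} (hξ0 : ξ ≠ 0) (hξ4 : ∀ h ∈ torsionFixing W (4 : ℤ), h1Eval W (2 : ℤ) ξ h = 0)
    (hξS : ξ ∈ W.selmerGroup 2)
    (hK : IsImaginaryQuadratic K) (hodd : Odd (discr K)) (hH : SatisfiesHeegnerHypothesis (W.conductorNorm ℤ) K)
    (h2K : ((Ideal.span {(2 : ℤ)}).primesOver (𝓞 K)).ncard = 2)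
    {ℓ₀ : ℕ} (hℓ₀ : ℓ₀.Prime) (hd : discr K = -(ℓ₀ : ℤ)) (hP : (4 : ℤ) ∣ W.frobeniusTrace ℓ₀)
    {ℓ : ℕ} (hℓ : ℓ.Prime) (hℓℓ₀ : ℓ ≠ ℓ₀) (hℓN : ¬ ℓ ∣ W.conductorNorm ℤ) (hF : FrobEqFrobInfty W K 2 ℓ)
    (hk : 2 ≤ Zhang2014.kolyvaginIndex W 2 ℓ) (hℓ8 : (8 : ℤ) ∣ -(ℓ : ℤ) - 1)
    (X : WeierstrassCurve ℚ) [X.IsElliptic] {CX : VariableChange ℚ} (hX : CX • W.quadraticTwist ((-(ℓ : ℤ) : ℤ) : ℚ) = X)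
    (X' : WeierstrassCurve ℚ) [X'.IsElliptic] {CX' : VariableChange ℚ} (hX' : CX' • W.quadraticTwist ((-(ℓ₀ : ℤ) * -(ℓ : ℤ) : ℤ) : ℚ) = X')
    (hrK : (X.baseChange K).mordellWeilRank = 1)
    (hrank : (X.mordellWeilRank = 0 ∧ Finite (AddCommGroup.primaryComponent X.sha 2)) ∨
      (X'.mordellWeilRank = 0 ∧ Finite (AddCommGroup.primaryComponent X'.sha 2))) :
    2 ≤ Nat.card ((X.baseChange K).sha ⊓ AddSubgroup.torsionBy (X.baseChange K).galH1 2 : AddSubgroup (X.baseChange K).galH1) := by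
  have hℓ2 : ℓ ≠ 2 := by
    rintro rfl
    omega
  have hD : (-(ℓ : ℤ)) ≠ 0 := neg_ne_zero.mpr (by exact_mod_cast hℓ.ne_zero)
  have hD0 : ((-(ℓ : ℤ) : ℤ) : ℚ) ≠ 0 := by exact_mod_cast hD
  -- the deep clauses of `D = −ℓ`
  have hdeep : ∀ (p : ℕ), p.Prime → p ≠ 2 → (p : ℤ) ∣ -(ℓ : ℤ) →
      ¬ p ∣ W.conductorNorm ℤ ∧ FrobEqFrobInfty W K 2 p ∧ 2 ≤ Zhang2014.kolyvaginIndex W 2 p := by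
    intro p hp _ hpD
    have hpℓ : p = ℓ := by
      have h : (p : ℤ) ∣ (ℓ : ℤ) := (dvd_neg).mp hpD
      exact (Nat.prime_dvd_prime_iff_eq hp hℓ).mp (by exact_mod_cast h)
    subst hpℓ
    exact ⟨hℓN, hF, hk⟩
  have hdeep' : ∀ (p : ℕ), p.Prime → p ≠ 2 → (p : ℤ) ∣ -(ℓ : ℤ) →
      p ≠ ℓ₀ ∧ ¬ p ∣ W.conductorNorm ℤ ∧ FrobEqFrobInfty W K 2 p ∧ 2 ≤ Zhang2014.kolyvaginIndex W 2 p := by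
    intro p hp hp2 hpD
    have hpℓ : p = ℓ := by
      have h : (p : ℤ) ∣ (ℓ : ℤ) := (dvd_neg).mp hpD
      exact (Nat.prime_dvd_prime_iff_eq hp hℓ).mp (by exact_mod_cast h)
    subst hpℓ
    exact ⟨hℓℓ₀, hℓN, hF, hk⟩
  -- `ρ̄_{X,2}` onto
  have hsX : X.HasSurjectiveModNGaloisRep 2 := hasSurjectiveModNGaloisRep_two_of_smul_quadraticTwist W hsurj hD0 X hX
  -- `X'` is a model of `X^{(d_K)}`: `(W^{(−ℓ)})^{(−ℓ₀)} = W^{(−ℓ₀ · −ℓ)}` up to changes of variables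
  have hX'q : CX' • W.quadraticTwist ((NumberField.discr K : ℚ) * ((-(ℓ : ℤ) : ℤ) : ℚ)) = X' := by
    rw [hd]; push_cast; push_cast at hX'; exact hX'
  obtain ⟨C'', hC''⟩ := exists_smul_quadraticTwist_eq_of_models W X X' hX hX'q
  -- both members carry `ξ`: `#Sel₂ ≥ 2`
  have hSX : 2 ≤ Nat.card (X.selmerGroup 2) :=
    two_le_natCard_selmerGroup_twist_of_phantom_selmer_of_kolyvaginPrimes W hT hoff hΔ hsurj hsurj4 hξ0 hξ4 hξS hD X hX (Or.inl hℓ8) hdeep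
  have hSX' : 2 ≤ Nat.card (X'.selmerGroup 2) :=
    two_le_natCard_selmerGroup_frameTwist_of_phantom_selmer_of_kolyvaginPrimes W hT hoff hΔ hsurj hsurj4 hξ0 hξ4 hξS hK hodd hH h2K
      hℓ₀ hd hP hD hℓ8 hdeep' X' hX'
  -- the rank-`0` member has `#Sel₂ ≥ 4` (Cassels–Tate); then §2
  rcases hrank with ⟨hr0, hfin⟩ | ⟨hr0, hfin⟩
  · haveI := hfin
    have h4 : 4 ≤ Nat.card (X.selmerGroup 2) := four_le_natCard_selmerGroup_of_rank_zero X hsX hr0 hSX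
    exact two_le_natCard_sha_baseChange_of_four_le_natCard_selmerGroup_twist X K hK hsX hrK X (C := 1)
      (Or.inl (one_smul _ X)) h4
  · haveI := hfin
    have hdK0 : (NumberField.discr K : ℚ) ≠ 0 := by exact_mod_cast NumberField.discr_ne_zero K
    have hsX' : X'.HasSurjectiveModNGaloisRep 2 := hasSurjectiveModNGaloisRep_two_of_smul_quadraticTwist X hsX hdK0 X' hC''
    have h4 : 4 ≤ Nat.card (X'.selmerGroup 2) := four_le_natCard_selmerGroup_of_rank_zero X' hsX' hr0 hSX'
    exact two_le_natCard_sha_baseChange_of_four_le_natCard_selmerGroup_twist X K hK hsX hrK X' (Or.inr hC'') h4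

end PFrameLedger

end Summit.BirchSwinnertonDyer.BirchSwinnertonDyer.Theorems.GenusExact.PhantomDescentBit.DeepTwist

end
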